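import Summits.QuantumFields.QCD.Theses.SpectralDefectExtinction
import Literature.MathematicalPhysics.QuantumFieldTheory.QCDPhaseQuenched
import Literature.MathematicalPhysics.QuantumLattice.WilsonDiracAP
import Summits.QuantumFields.QCD.Theorems.HeatSlicedQuarksInterleavedFlowProperStubFineWeightAdmissible

/-!
# Stub Π `stub_seaWeightPositive` — the honest all-antiperiodic partition function is positive on
every odd torus (crux stmt-QuantumFields-18064 `ExtinctionBuildsQCD`, line `block-away-the-sign`,
registered line lemma of Stub C's SeaAdmissible: clause `0 < ∫ w` of `AdmAt`)

For `β_k ≥ 0`, bare masses on the physical branch `m_f(k) > −1` (`κ_f < 1/6`) and `S ≥ 1`,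
`0 < ∫ exp(−β_k S_W(U)) Re ∏_f det D_W^{AP}(U, m_f(k)) ∏ dU_e` (Haar product measure; quarks antiperiodic
in ALL four directions, `Literature.MathematicalPhysics.QuantumLattice.wilsonDiracAP`). Classically this is
Lüscher's `Z = Tr 𝕋^{2S+1} > 0` for the positive transfer matrix of `r = 1` Wilson lattice QCD; the tree
proof (`fineWeight_partitionPos` of the HeatSlicedQuarks line, crux stmt-QuantumFields-18031, LANDED)
obtains it from reflection positivity alone (odd-torus kernel mechanism, vacuum eigenvector of the
flavour Kronecker kernel). RESHAPE (lead, cycle 2): the registered signature now carries `0 ≤ β_k`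
(the cycle-1 registration omitted it; positivity of the signed partition function at negative `β` is
not what the sources prove and is not needed — `β_k → ∞` along every SD⁺ witness).

References: M. Lüscher, Commun. Math. Phys. 54 (1977) 283, §§2–3; I. Montvay, G. Münster,
*Quantum Fields on a Lattice* (1994), §4.1.3 (4.34), §4.2.3 (4.111), §4.2.4; K. Osterwalder, E. Seiler,
Ann. Phys. 110 (1978) 440, §3.
-/

noncomputable section

namespace Summit.QuantumFields.QCD.Cruxes.ExtinctionBuildsQCD.BlockAwayTheSign

open scoped BigOperators Topology Classical MeasureTheory Matrix
open Filter MeasureTheory Matrix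
open Literature.MathematicalPhysics.QuantumLattice Literature.MathematicalPhysics.AQFT
  Literature.MathematicalPhysics.QuantumFieldTheory
open Summit.QuantumFields.QCD.Theses.SpectralDefectExtinction
open Summit.QuantumFields.QCD.Theses

/-- **Stub Π `stub_seaWeightPositive` — the honest all-antiperiodic partition function is positive on
EVERY odd torus (registered line lemma of Stub C's SeaAdmissible, clause `0 < ∫ w` of `AdmAt`; classical:
Lüscher positivity).** For `β_k ≥ 0`, bare masses on the physical branch (`m_f(k) > −1`, i.e. `κ_f < 1/6`)
and `S ≥ 1`, `∫ exp(−β_k S_W(U)) Re∏_f det D_W^{AP}(U, m_f(k)) dU > 0` (Haar product measure). It is the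
landed `fineWeight_partitionPos` of the HeatSlicedQuarks line at `β = β_k`, `m_f = m_crit(k) + a_k m_f / Z_m(k)`
(positivity from reflection positivity: the flavour Kronecker kernel of the odd-torus mechanism dominates a
rank-one vacuum kernel with positive eigenvalue). [cite: Luscher1977, §§2–3] [cite: MontvayMunster1994,
§4.1.3 (4.34), §4.2.3 (4.111), §4.2.4] [cite: OsterwalderSeiler1978, §3] -/
theorem stub_seaWeightPositive :
    ∀ {Nf : ℕ} (reg : QCDRegularisation Nf) (m : Fin Nf → ℝ) (k S : ℕ), 1 ≤ S → 0 ≤ reg.β k →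
      (∀ fl : Fin Nf, -1 < reg.mcrit k + reg.a k * m fl / reg.Zm k) →
      0 < ∫ (U : GaugeConfig 4 (2 * S + 1) SU3),
          Real.exp (-(reg.β k * wilsonAction (fundamentalRep (Fin 3)) U)) *
            (∏ fl : Fin Nf, fermionDet (Literature.MathematicalPhysics.QuantumLattice.wilsonDiracAP U (reg.mcrit k + reg.a k * m fl / reg.Zm k))).re
        ∂(Measure.pi fun _ : Edge 4 (2 * S + 1) => haarProbability SU3) := by
  intro Nf reg m k S hS hβ hm
  exact Summit.QuantumFields.QCD.Cruxes.InterleavedFlowProper.OffsetLastFormatHandover.fineWeight_partitionPos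
    (reg.β k) (fun fl => reg.mcrit k + reg.a k * m fl / reg.Zm k) hβ hm S hS

end Summit.QuantumFields.QCD.Cruxes.ExtinctionBuildsQCD.BlockAwayTheSign

end
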